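import Summits.KontsevichZagierPeriods.KontsevichZagierPeriods.Theorems.RootDecompQuadraticDescentZ7ComposeP3

/-! # `RootDecompQuadraticDescentZ7ComposeP4` — part 4/5 of the mechanical ≤400-line split of `Z7Compose.lean` (sha256 65b37838cbe1d1d8…)
Source: decomp-kz lens-6 g11 `Z7Compose.lean` v2 (HOME/decomp-kz-lens-6/g11/, sha256 65b37838…; critic g5-39/g5-47/g5-52 CLEARED, writer A2.4: land Z7Compose v2 + RayAffineRational --supports 28994): K26a / Zagier's Z₇ decided inside the ℚ-rational weight-2 box of crux 28994 — z7_pair: ∃ r r' ℚ-rational with the same integrand 1/(2v(1+τ²)), [r] ≡ 6[T(u)]+6[T(ū²)]+2[T(u³)]+7[T(ζ₇³)], [r'] ≡ 7[T(ζ₇)]+7[T(ζ₇²)], r.value = r'.value, [r] − [r'] ∈ KZ.relations, over five binders = verbatim tree-theorem types; landed by census-1 g9.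
Split by census-1 g9 `gen/splitlean.py`: scopes re-opened with their `open`/`variable`/`set_option` context; mathematics and declaration order unchanged. -/

noncomputable section
open scoped BigOperators ComplexConjugate
open Set
open Literature.NumberTheory.Transcendental
namespace Summit.KontsevichZagierPeriods.RootDecompQuadraticDescent.Z7Compose
section Pair
open MeasureTheory MvPolynomial
open Literature.ModelTheory.ExponentialFields (IsSemialgebraic isSemialgebraic_setOf_eval_lt)

/-- On the unit circle (`a² + b² = 1`) the affine piece lies in the window `0 < a + bτ < 1` and in the slab
`0 < v < 1`. [folklore] -/
theorem affDomain_facts {a b : ℝ} (hN : a ^ 2 + b ^ 2 = 1) {w : Fin 2 → ℝ} (hw : w ∈ affDomain a b) :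
    (0 < a + b * w 0 ∧ a + b * w 0 < 1) ∧ 0 < w 1 ∧ w 1 < 1 := by
  obtain ⟨h0, h1, hsh⟩ := hw
  rw [hN] at h1 hsh
  rcases hsh with ⟨hu1, hc⟩ | ⟨hc, hu1⟩
  · exfalso
    nlinarith
  · refine ⟨⟨h0, h1⟩, ?_, hu1⟩
    nlinarith [sq_nonneg (a + b * w 0), mul_pos h0 h0]

/-- On the unit-circle pieces the affine integrand IS `g`. [folklore] -/
theorem affIntegrand_eq_gInt {a b : ℝ} (hN : a ^ 2 + b ^ 2 = 1) {w : Fin 2 → ℝ}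
    (hw : w ∈ affDomain a b) : affIntegrand w = gInt w := by
  have h := (affDomain_facts hN hw).2.2
  rw [affIntegrand, if_neg (not_lt.mpr h.le), gInt]
  ring

/-- `sin(π/7) > 0`. [folklore] -/
theorem sin_pi_div_seven_pos : 0 < Real.sin (Real.pi / 7) :=
  Real.sin_pos_of_pos_of_lt_pi (by positivity) (by linarith [Real.pi_pos])

/-- `sin(π/7) < cos(π/7)` (`cos(π/7) = sin(5π/14)`). [folklore] -/
theorem sin_lt_cos_pi_div_seven : Real.sin (Real.pi / 7) < Real.cos (Real.pi / 7) := by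
  rw [← Real.sin_pi_div_two_sub]
  exact Real.sin_lt_sin_of_lt_of_le_pi_div_two (by linarith [Real.pi_pos]) (by linarith [Real.pi_pos])
    (by linarith [Real.pi_pos])

/-- `ζ₇³ = −cos(π/7) + i sin(π/7)`. [folklore] -/
theorem zeta3_re_im :
    (Complex.exp (2 * Real.pi * Complex.I / 7) ^ 3).re = -Real.cos (Real.pi / 7) ∧
    (Complex.exp (2 * Real.pi * Complex.I / 7) ^ 3).im = Real.sin (Real.pi / 7) := by
  obtain ⟨hr, hi⟩ := zeta_pow_re_im 3
  rw [hr, hi]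
  have e : (2 * Real.pi * ((3 : ℕ) : ℝ) / 7 : ℝ) = Real.pi - Real.pi / 7 := by
    push_cast
    ring
  rw [e, Real.cos_pi_sub, Real.sin_pi_sub]
  exact ⟨rfl, rfl⟩

/-- The windows of `u` and `ū²` are disjoint: `√7 τ > 3` versus `3√7 τ < 7`. [folklore] -/
theorem sepA {t : ℝ} (h1 : 0 < -3 / 4 + Real.sqrt 7 / 4 * t)
    (h2 : 1 / 8 + 3 * Real.sqrt 7 / 8 * t < 1) : False := by
  nlinarith [Real.sqrt_nonneg 7]

/-- The windows of `u³` and `ζ₇³` are disjoint: `5√7 τ < 7` forces `τ < 1`, `cos(π/7) < sin(π/7) τ`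
forces `τ > 1`. [folklore] -/
theorem sepB {t : ℝ} (h1 : 9 / 16 + 5 * Real.sqrt 7 / 16 * t < 1)
    (h2 : 0 < -Real.cos (Real.pi / 7) + Real.sin (Real.pi / 7) * t) : False := by
  have hs := sin_pi_div_seven_pos
  have hsc := sin_lt_cos_pi_div_seven
  have h7 : Real.sqrt 7 ^ 2 = 7 := Real.sq_sqrt (by norm_num)
  have h7' : 0 ≤ Real.sqrt 7 := Real.sqrt_nonneg 7
  have hgt : (7 : ℝ) / 5 < Real.sqrt 7 := by nlinarith
  have ht : 1 < t := by
    refine lt_of_not_ge fun h => ?_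
    have := mul_le_mul_of_nonneg_left h hs.le
    nlinarith
  nlinarith

end Pair

section PairMain

open MeasureTheory MvPolynomial
open Literature.ModelTheory.ExponentialFields (IsSemialgebraic)

end PairMain
end Summit.KontsevichZagierPeriods.RootDecompQuadraticDescent.Z7Compose
end
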